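import Mathlib.Data.Nat.Log
import Literature.Computability.Complexity.GraphCanonizationFinalParts
import Literature.Computability.Complexity.GraphCanonizationPotential
import HarnessLib

/-!
# The section/individualization canoniser has a simply-exponential recursion tree (`2^{O(k)}` nodes)

The `C^k` bound for the canoniser `CGCanon.canon` (`GraphCanonizationScheme.lean`) — the content
of [CorneilGoldberg1984, §4] / [Laubner2011, §3.5, Prop. 3.5.2], here proved by the potential
`Θ_q` of `GraphCanonizationPotential.lean` instead of the printed level count (which does not
treat sections). At the dyadic scales `q_j = 2^{j+1}`, `j < L := log₂ k + 1`:

* `CGCanon.bud W c = ∑_j ⌊Θ_{q_j}(W, c) / k⌋` — the BUDGET of a state (`≤ 12 k`, `bud_le`);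
  `CGCanon.bigcount d = #{j < L : k < q_j d}` — the scales at which a branching of degree `d` is
  big; `lt_two_pow_bigcount : d < 2 ^ bigcount d` (the scales `j ≥ L - 1 - log₂ d` all count).
* **`lam_le_two_pow`** — for a connected equitable state with two vertices,
  `lam R G W c ≤ 2 ^ (bud W c + bigcount |A|)`: the next branching states are final parts `K` of
  the refined states; by `theta_mono_subset`/`theta_mono_refines` their budgets are not larger,
  and at every scale at which `K` branches big the potential has dropped by `k` (`theta_drop`, the
  split class supplied by `exists_split_of_small_discard`), so `bud K + bigcount |A_K| ≤ bud W`;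
  and `|A| < 2 ^ bigcount |A|`.
* `lam_le_of_isEqui`, **`cost_le_two_pow`**: for every equitable state
  `cost R G W c ≤ 2 ^ (14 k + 1)`; in particular for the root state of the canonical form
  (`cost_root_le_two_pow`).

## References

* D. G. Corneil, M. K. Goldberg, J. Algorithms 5 (1984) 345–362, §4. [CorneilGoldberg1984]
* B. Laubner, PhD thesis, HU Berlin 2011, doi:10.18452/16335, §3.5, Prop. 3.5.2. [Laubner2011]
-/

namespace Literature.Computability.Complexity

open Literature.Combinatorics.SimpleGraph Finset ColourRefinementScheme

open scoped Classical

noncomputable section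

namespace CGCanon

variable {k : ℕ}

/-! ### Scales, budgets, big counts -/

/-- The number of dyadic scales, `L = log₂ k + 1` (so `k < 2^L ≤ 2k`). [folklore] -/
def scales (k : ℕ) : ℕ := Nat.log 2 k + 1

/-- `k < 2 ^ L`. [folklore] -/
theorem lt_two_pow_scales (k : ℕ) : k < 2 ^ scales k := Nat.lt_pow_succ_log_self one_lt_two k

/-- `2 ^ L ≤ 2 k` for `k ≠ 0`. [folklore] -/
theorem two_pow_scales_le {k : ℕ} (hk : k ≠ 0) : 2 ^ scales k ≤ 2 * k := by
  rw [scales, pow_succ]; have := Nat.pow_log_le_self 2 hk; omega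

/-- **The budget** of a state: `∑_{j < L} ⌊Θ_{2^{j+1}}(W, c) / k⌋`. [folklore] -/
def bud (W : Finset (Fin k)) (c : Fin k → ℕ) : ℕ := ∑ j ∈ range (scales k), theta (2 ^ (j + 1)) W c / k

/-- **The big count** of a degree `d`: the number of scales `j < L` with `k < 2^{j+1} d`. [folklore] -/
def bigcount (k d : ℕ) : ℕ := ((range (scales k)).filter fun j => k < 2 ^ (j + 1) * d).card

/-- `bigcount d ≤ L`. [folklore] -/
theorem bigcount_le (k d : ℕ) : bigcount k d ≤ scales k := (card_filter_le _ _).trans (card_range _).le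

/-- **`d < 2 ^ bigcount d`** for `1 ≤ d ≤ k`: the `log₂ d + 1` top scales all count. [folklore] -/
theorem lt_two_pow_bigcount {k d : ℕ} (hd : 1 ≤ d) (hdk : d ≤ k) : d < 2 ^ bigcount k d := by
  have hd0 : d ≠ 0 := by omega
  have hlog : Nat.log 2 d ≤ Nat.log 2 k := Nat.log_mono_right hdk
  -- the injection `i ↦ L - 1 - i` from `range (log₂ d + 1)`
  have hcount : Nat.log 2 d + 1 ≤ bigcount k d := by
    rw [bigcount, ← card_range (Nat.log 2 d + 1)]
    refine card_le_card_of_injOn (fun i => Nat.log 2 k - i) (fun i hi => ?_) ?_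
    · rw [mem_coe, mem_range] at hi
      show Nat.log 2 k - i ∈ _
      rw [mem_coe, mem_filter, mem_range, scales]
      refine ⟨by omega, ?_⟩
      have h1 : 2 ^ i ≤ d := (Nat.pow_le_pow_right two_pos (by omega)).trans (Nat.pow_log_le_self 2 hd0)
      have h2 : Nat.log 2 k - i + 1 + i = Nat.log 2 k + 1 := by omega
      calc k < 2 ^ (Nat.log 2 k + 1) := Nat.lt_pow_succ_log_self one_lt_two k
        _ = 2 ^ (Nat.log 2 k - i + 1) * 2 ^ i := by rw [← pow_add, h2]
        _ ≤ 2 ^ (Nat.log 2 k - i + 1) * d := Nat.mul_le_mul_left _ h1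
    · intro i hi i' hi' h
      rw [mem_coe, mem_range] at hi hi'
      have : Nat.log 2 k - i = Nat.log 2 k - i' := h
      omega
  calc d < 2 ^ (Nat.log 2 d + 1) := Nat.lt_pow_succ_log_self one_lt_two d
    _ ≤ 2 ^ bigcount k d := Nat.pow_le_pow_right two_pos hcount

/-- The budget of a subset is not larger. [folklore] -/
theorem bud_mono_subset {K W : Finset (Fin k)} (hKW : K ⊆ W) (c : Fin k → ℕ) : bud K c ≤ bud W c :=
  sum_le_sum fun _ _ => Nat.div_le_div_right (theta_mono_subset _ hKW c)

/-- **`bud W c ≤ 12 k`.** [folklore] -/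
theorem bud_le (W : Finset (Fin k)) (c : Fin k → ℕ) : bud W c ≤ 12 * k := by
  rcases Nat.eq_zero_or_pos k with hk | hk
  · subst hk; simp [bud]
  have h1 : ∀ j ∈ range (scales k), theta (2 ^ (j + 1)) W c / k ≤ 3 * 2 ^ (j + 1) := fun j _ =>
    Nat.div_le_of_le_mul (by
      calc theta (2 ^ (j + 1)) W c ≤ 3 * 2 ^ (j + 1) * W.card := theta_le _ W c
        _ ≤ 3 * 2 ^ (j + 1) * k := Nat.mul_le_mul_left _ ((card_le_univ W).trans (by simp))
        _ = k * (3 * 2 ^ (j + 1)) := by ring)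
  have h2 : ∑ j ∈ range (scales k), 3 * 2 ^ (j + 1) = 6 * (2 ^ scales k - 1) := by
    have : ∀ n : ℕ, ∑ j ∈ range n, 3 * 2 ^ (j + 1) = 6 * (2 ^ n - 1) := by
      intro n; induction n with
      | zero => simp
      | succ n ih =>
        rw [sum_range_succ, ih, pow_succ]
        have : 1 ≤ 2 ^ n := Nat.one_le_two_pow
        omega
    exact this _
  have h3 := two_pow_scales_le (k := k) (by omega)
  calc bud W c ≤ ∑ j ∈ range (scales k), 3 * 2 ^ (j + 1) := sum_le_sum h1
    _ = 6 * (2 ^ scales k - 1) := h2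
    _ ≤ 12 * k := by omega

/-! ### States, cells and the branching cell -/

variable {G : SimpleGraph (Fin k)} {W : Finset (Fin k)} {c : Fin k → ℕ}

/-- In a costly state the branching cell is no larger than any cell. [folklore] -/
theorem card_bigMinCell_le_card_cell {x v : Fin k} (hx : x ∈ bigMinCell W c) (hv : v ∈ W) (h2 : 2 ≤ (cell W c v).card) :
    (bigMinCell W c).card ≤ (cell W c v).card := by
  rw [bigMinCell_eq_cell hx]
  obtain ⟨-, -, hmin⟩ := mem_bigMinCell.1 hx
  have h := hmin v hv h2
  unfold cellKey at h
  rcases (Prod.Lex.le_iff (x := ((cell W c x).card, c x)) (y := ((cell W c v).card, c v))).1 h with h | ⟨h, -⟩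
  · exact h.le
  · exact h.le

/-- Individualization refines. [folklore] -/
theorem eq_of_individualize_eq {c : Fin k → ℕ} {x u v : Fin k} (h : individualize c x u = individualize c x v) : c u = c v := by
  unfold individualize at h
  by_cases hu : u = x <;> by_cases hv : v = x
  · rw [hu, hv]
  · rw [if_pos hu, if_neg hv] at h; exact absurd h.symm (Nat.succ_ne_zero _)
  · rw [if_neg hu, if_pos hv] at h; exact absurd h (Nat.succ_ne_zero _)
  · rw [if_neg hu, if_neg hv] at h; exact Nat.succ_injective h

/-- The refined colouring after individualizing `x` refines `c` on `W`. [folklore] -/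
theorem refine_individualize_refines (R : Refiner k) (G : SimpleGraph (Fin k)) (W : Finset (Fin k)) (c : Fin k → ℕ) (x : Fin k)
    ⦃u v : Fin k⦄ (hu : u ∈ W) (hv : v ∈ W) (h : R.refine G W (individualize c x) u = R.refine G W (individualize c x) v) : c u = c v :=
  eq_of_individualize_eq (R.refines G W _ hu hv h)

/-- After individualizing `x ∈ W`, only `x` wears its refined colour on `W`. [folklore] -/
theorem eq_of_refine_individualize_eq_self (R : Refiner k) (G : SimpleGraph (Fin k)) (W : Finset (Fin k)) (c : Fin k → ℕ)
    {x w : Fin k} (hx : x ∈ W) (hw : w ∈ W) (h : R.refine G W (individualize c x) w = R.refine G W (individualize c x) x) : w = x := by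
  have := R.refines G W _ hw hx h
  unfold individualize at this
  by_contra hwx
  rw [if_neg hwx, if_pos rfl] at this
  exact Nat.succ_ne_zero _ this

/-! ### The main bound -/

/-- **The chain product of a connected equitable state with two vertices is at most
`2 ^ (budget + big count of its branching degree)`.** [cite: Laubner2011, Prop. 3.5.2] -/
theorem lam_le_two_pow (R : Refiner k) (G : SimpleGraph (Fin k)) :
    ∀ (W : Finset (Fin k)) (c : Fin k → ℕ), ¬ W.card ≤ 1 → IsConn G W c → IsEqui G W c →
      lam R G W c ≤ 2 ^ (bud W c + bigcount k (bigMinCell W c).card) := by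
  suffices H : ∀ (n m : ℕ) (W : Finset (Fin k)) (c : Fin k → ℕ), W.card = n → W.card - (W.image c).card = m →
      ¬ W.card ≤ 1 → IsConn G W c → IsEqui G W c → lam R G W c ≤ 2 ^ (bud W c + bigcount k (bigMinCell W c).card) from
    fun W c => H _ _ W c rfl rfl
  intro n
  induction n using Nat.strong_induction_on with
  | _ n ihn =>
  intro m
  induction m using Nat.strong_induction_on with
  | _ m ihm =>
  intro W c hn hm hW hconn hE
  have hk : 0 < k := lt_of_lt_of_le (by omega) ((card_le_univ W).trans_eq (by simp))
  obtain ⟨u₀, hu₀⟩ : W.Nonempty := card_pos.1 (by omega)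
  have hA : (bigMinCell W c).Nonempty := bigMinCell_nonempty ⟨u₀, hu₀, hE.two_le_card_cell hconn (by omega) hu₀⟩
  rw [lam_of_isConn hW hconn hA]
  -- every next branching state fits in the budget of `(W, c)`
  have key : ∀ x ∈ bigMinCell W c, lam R G W (R.refine G W (individualize c x)) ≤ 2 ^ bud W c := by
    intro x hx
    obtain ⟨hxW, -, -⟩ := mem_bigMinCell.1 hx
    set c' := R.refine G W (individualize c x) with hc'
    have href : ∀ ⦃u v : Fin k⦄, u ∈ W → v ∈ W → c' u = c' v → c u = c v := refine_individualize_refines R G W c x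
    have hE' : IsEqui G W c' := R.isEqui G W _
    refine (lam_le_sup_fparts R G W c').trans (Finset.sup_le fun K hK => ?_)
    have hKW : K ⊆ W := subset_of_mem_fparts hK
    by_cases hK1 : K.card ≤ 1
    · rw [lam_of_card_le_one hK1]; exact Nat.one_le_two_pow
    have hKconn : IsConn G K c' := (stop_of_mem_fparts hK).resolve_right hK1
    have hKE : IsEqui G K c' := hE'.of_mem_fparts hK
    have hKne : K.Nonempty := card_pos.1 (by omega)
    -- induction hypothesis for the costly state `(K, c')`
    have ih : lam R G K c' ≤ 2 ^ (bud K c' + bigcount k (bigMinCell K c').card) := by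
      rcases (card_le_card hKW).lt_or_eq with hlt | heq
      · exact ihn K.card (hn ▸ hlt) _ K c' rfl rfl hK1 hKconn hKE
      · have hKeq : K = W := eq_of_subset_of_card_le hKW heq.ge
        subst hKeq
        exact ihm _ (hm ▸ measure_lt_of_mem_bigMinCell R G K c hx) K c' hn rfl hK1 hKconn hKE
    refine ih.trans (Nat.pow_le_pow_right two_pos ?_)
    -- per scale: `⌊Θ(K, c')/k⌋ + [K big] ≤ ⌊Θ(W, c)/k⌋`
    unfold bud bigcount
    rw [card_filter, ← sum_add_distrib]
    refine sum_le_sum fun j _ => ?_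
    have hmono : theta (2 ^ (j + 1)) K c' ≤ theta (2 ^ (j + 1)) W c :=
      (theta_mono_subset _ hKW c').trans (theta_mono_refines _ href)
    split_ifs with hbig
    · -- the drop at a big scale
      have hAK : (bigMinCell K c').Nonempty := by
        obtain ⟨v, hv⟩ := hKne
        exact bigMinCell_nonempty ⟨v, hv, hKE.two_le_card_cell hKconn (by omega) hv⟩
      obtain ⟨y, hy⟩ := hAK
      have hlarge : ∀ v ∈ K, k < 2 ^ (j + 1) * (cls K c' (c' v)).card := fun v hv =>
        hbig.trans_le (Nat.mul_le_mul_left _ (by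
          rw [cls_eq_cell]; exact card_bigMinCell_le_card_cell hy hv (hKE.two_le_card_cell hKconn (by omega) hv)))
      have hxK : x ∉ K := fun hxK => by
        have h2 := hKE.two_le_card_cell hKconn (by omega) hxK
        have h1 : (cell K c' x).card ≤ 1 := card_le_one.2 fun a ha b hb => by
          rw [mem_cell] at ha hb
          rw [eq_of_refine_individualize_eq_self R G W c hxW (hKW ha.1) ha.2,
            eq_of_refine_individualize_eq_self R G W c hxW (hKW hb.1) hb.2]
        omega
      have hdrop : theta (2 ^ (j + 1)) K c' + k ≤ theta (2 ^ (j + 1)) W c := by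
        refine theta_drop hKW href hlarge ?_
        by_cases hD : k ≤ 2 * 2 ^ (j + 1) * (W \ K).card
        · exact Or.inl hD
        · exact Or.inr (exists_split_of_small_discard hE hconn href hKW hKne hxW hxK
            (fun u hu huK v hv w hw hvw => adj_iff_adj_of_mem_fparts hK hu huK hv hw hvw) hlarge (not_le.1 hD))
      calc theta (2 ^ (j + 1)) K c' / k + 1 = (theta (2 ^ (j + 1)) K c' + k) / k := (Nat.add_div_right _ hk).symm
        _ ≤ theta (2 ^ (j + 1)) W c / k := Nat.div_le_div_right hdrop
    · simpa using Nat.div_le_div_right hmono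
  -- assemble: `|A| · max ≤ 2^{bigcount |A|} · 2^{bud}`
  have hsup : ((bigMinCell W c).attach.sup fun x => lam R G W (R.refine G W (individualize c x.1))) ≤ 2 ^ bud W c :=
    Finset.sup_le fun x _ => key x.1 x.2
  have hAlt : (bigMinCell W c).card < 2 ^ bigcount k (bigMinCell W c).card :=
    lt_two_pow_bigcount (card_pos.2 hA) (((card_le_card (filter_subset _ W)).trans (card_le_univ W)).trans_eq (by simp))
  calc (bigMinCell W c).card * ((bigMinCell W c).attach.sup fun x => lam R G W (R.refine G W (individualize c x.1)))
      ≤ 2 ^ bigcount k (bigMinCell W c).card * 2 ^ bud W c := Nat.mul_le_mul hAlt.le hsup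
    _ = 2 ^ (bud W c + bigcount k (bigMinCell W c).card) := by rw [← pow_add, Nat.add_comm]

/-- **The chain product of an equitable state** is at most `2 ^ (bud + L)`. [cite: Laubner2011, Prop. 3.5.2] -/
theorem lam_le_of_isEqui (R : Refiner k) (G : SimpleGraph (Fin k)) (W : Finset (Fin k)) (c : Fin k → ℕ) (hE : IsEqui G W c) :
    lam R G W c ≤ 2 ^ (bud W c + scales k) := by
  refine (lam_le_sup_fparts R G W c).trans (Finset.sup_le fun K hK => ?_)
  by_cases hK1 : K.card ≤ 1
  · rw [lam_of_card_le_one hK1]; exact Nat.one_le_two_pow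
  have hKconn : IsConn G K c := (stop_of_mem_fparts hK).resolve_right hK1
  refine (lam_le_two_pow R G K c hK1 hKconn (hE.of_mem_fparts hK)).trans (Nat.pow_le_pow_right two_pos ?_)
  exact Nat.add_le_add (bud_mono_subset (subset_of_mem_fparts hK) c) (bigcount_le k _)

/-- **The recursion tree of an equitable state has at most `2 ^ (14 k + 1)` nodes.** [cite: CorneilGoldberg1984, §4] -/
theorem cost_le_two_pow (R : Refiner k) (G : SimpleGraph (Fin k)) (W : Finset (Fin k)) (c : Fin k → ℕ) (hE : IsEqui G W c) :
    cost R G W c ≤ 2 ^ (14 * k + 1) := by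
  rcases W.eq_empty_or_nonempty with rfl | hWne
  · rw [cost_of_card_le_one (by simp)]; exact Nat.one_le_two_pow
  have hk : k ≠ 0 := by
    obtain ⟨u, -⟩ := hWne; exact Nat.pos_iff_ne_zero.1 (Fin.pos u)
  have h1 := cost_succ_le R G hWne c
  have h2 := lam_le_of_isEqui R G W c hE
  have h3 := bud_le W c
  have h4 : scales k ≤ k := by rw [scales]; have := Nat.log_lt_self 2 hk; omega
  have h5 : W.card ≤ k := (card_le_univ W).trans_eq (by simp)
  have h6 : k ≤ 2 ^ k := Nat.lt_two_pow_self.le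
  calc cost R G W c ≤ 2 * W.card * lam R G W c := by omega
    _ ≤ 2 * k * 2 ^ (12 * k + k) := Nat.mul_le_mul (Nat.mul_le_mul_left 2 h5) (h2.trans (Nat.pow_le_pow_right two_pos (by omega)))
    _ ≤ 2 * 2 ^ k * 2 ^ (12 * k + k) := Nat.mul_le_mul_right _ (Nat.mul_le_mul_left 2 h6)
    _ = 2 ^ (14 * k + 1) := by rw [← pow_succ', ← pow_add]; ring_nf

/-- **The recursion tree of the canonical form of a coloured graph on `k` vertices has at most
`2 ^ (14 k + 1)` nodes.** [cite: CorneilGoldberg1984, §4] -/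
theorem cost_root_le_two_pow (R : Refiner k) (G : SimpleGraph (Fin k)) (col : Fin k → ℕ) :
    cost R G univ (R.refine G univ col) ≤ 2 ^ (14 * k + 1) :=
  cost_le_two_pow R G univ _ (R.isEqui G univ col)

end CGCanon

end

end Literature.Computability.Complexity
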